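import Literature.Analysis.FluidPDE.NSVorticityBKMHolds
import Summits.NavierStokesRegularity.NavierStokesRegularity.Theorems.CertifiedBlowupCertifiedBlowupAxisymBlowupSwirlPersists
import HarnessLib

/-!
# Witnesses of the crux `CertifiedBlowupAxisymBlowup` are vorticity blow-ups (Beale–Kato–Majda)

Theorems file landed `--supports stmt-NavierStokesRegularity-0727`, line `compact-amplification`
(continuation lead c3, wave 1; registered stub `lintegral_iSup_curl_eq_top_of_isMaximalSmoothSolution`).
The crux asks for a viscosity `ν > 0`, a time `T > 0` and a maximal smooth solution `(u, p)` of
lifespan `T`, Leray–Hopf on `[0, T]` from its rapidly decaying axisymmetric datum `u 0`. This file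
proves, for an ARBITRARY such witness `(ν, T, u, p)` and using only proved theorems of the tree:

* `hasBoundedSobolevNormsOn_before_of_lerayHopf_classical`: the solution lies in the
  Beale–Kato–Majda class `⋂ₛ L^∞([0, T'']; H^s)` on every earlier slab `[0, T'']`, `T'' < T`
  (no maximality, no axisymmetry needed) — it agrees on `[0, t]`, `T'' < t < T`, with the Tao-class
  development of its datum (`exists_isTaoSolutionOn_of_lerayHopf_classical`), whose Sobolev norms of
  all orders are bounded (`IsTaoSolutionOn.sobolev`);
* `not_hasSobolevExtensionPast_of_isMaximalSmoothSolution`: a maximal smooth solution admits no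
  continuation in the BKM class past `T` (`HasSobolevExtensionPast.hasSmoothExtensionPast`);
* `lintegral_iSup_curl_eq_top_of_isMaximalSmoothSolution` (the registered stub): hence, by the
  discharged blow-up form of the Beale–Kato–Majda criterion
  (`lintegral_iSup_curl_eq_top_of_not_hasSobolevExtensionPast_holds`, Beale–Kato–Majda 1984 Thm. 1,
  Majda–Bertozzi 2002 Thm. 3.6 / Thm. 4.3), `∫₀ᵀ ‖curl u(t)‖_{L^∞} dt = ∞`: **every axisymmetric
  blow-up is a vorticity blow-up**.

No new definitions, no named-fact hypotheses, no `sorry`.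

## References

* J. T. Beale, T. Kato, A. Majda, *Remarks on the breakdown of smooth solutions for the 3-D Euler
  equations*, Comm. Math. Phys. 94 (1984), 61–66: Theorem 1 and Corollary. [BealeKatoMajda1984]
* A. J. Majda, A. L. Bertozzi, *Vorticity and Incompressible Flow*, CUP 2002: Thm. 3.6 (p. 115),
  Thm. 4.3. [MajdaBertozzi2002]
* P. G. Lemarié-Rieusset, *The Navier–Stokes Problem in the 21st Century*, CRC 2016, Thm. 7.2 and
  Prop. 12.3. [LemarieRieusset2016]
-/

-- the summit and its single problem share the name (D-0017 nested layout)
set_option linter.dupNamespace false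

noncomputable section

open MeasureTheory Set Function Filter Topology Metric
open scoped ENNReal NNReal

namespace Summit.NavierStokesRegularity.NavierStokesRegularity.Theorems.CertifiedBlowupAxisymBlowup.CompactAmplification

open Literature.Analysis.FluidPDE

section Witness

variable {ν T : ℝ} {u : ℝ → (EuclideanSpace ℝ (Fin 3)) → (EuclideanSpace ℝ (Fin 3))} {p : ℝ → (EuclideanSpace ℝ (Fin 3)) → ℝ}

/-- **A classical Leray–Hopf solution from a rapidly decaying datum lies in the Beale–Kato–Majda
class on every earlier slab**: for `T'' < T` all `L²` Sobolev norms `∫ ‖Dⁿ u(t)‖²`, `n ∈ ℕ`, are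
bounded uniformly in `t ∈ [0, T'']`. For `T'' < 0` the slab is empty; for `0 ≤ T'' < T` the solution
agrees on `[0, t]`, `t = (T'' + T)/2`, with the Tao-class development `(U, P)` of `u 0`
(`exists_isTaoSolutionOn_of_lerayHopf_classical`), and `U ∈ L^∞_t H^n_x([0, t] × ℝ³)` for all `n`
(`IsTaoSolutionOn.sobolev`). No maximality and no axisymmetry are needed. [cite: LemarieRieusset2016, Thm. 7.2 and Prop. 12.3] -/
theorem hasBoundedSobolevNormsOn_before_of_lerayHopf_classical (hν : 0 < ν) (hT : 0 < T)
    (hcl : IsClassicalNSSolutionOn (Ico 0 T) ν 0 u p) (hLH : IsLerayHopfOn T ν 0 (u 0) u)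
    (hdec : HasRapidSpatialDecay (u 0)) :
    ∀ T'' < T, HasBoundedSobolevNormsOn (Icc 0 T'') u := by
  intro T'' hT''
  rcases lt_or_ge T'' 0 with h | h
  · -- empty slab
    intro n
    exact ⟨0, fun t ht => absurd (ht.1.trans ht.2) (not_le.2 h)⟩
  · -- `0 ≤ T'' < t < T`, `t = (T'' + T) / 2`
    set t : ℝ := (T'' + T) / 2 with ht_def
    have ht0 : 0 < t := by rw [ht_def]; linarith
    have htT : t < T := by rw [ht_def]; linarith
    have hT''t : T'' ≤ t := by rw [ht_def]; linarith
    obtain ⟨U, P, hU, hUeq⟩ :=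
      exists_isTaoSolutionOn_of_lerayHopf_classical hν hT hcl hLH hdec ht0 htT
    intro n
    obtain ⟨C, hC⟩ := hU.sobolev n
    refine ⟨C, fun s hs => ?_⟩
    have hsI : s ∈ Icc 0 t := ⟨hs.1, hs.2.trans hT''t⟩
    rw [← hUeq s hsI]
    exact hC s hsI

/-- **A maximal smooth solution admits no continuation in the Beale–Kato–Majda class past its
lifespan**: a continuation in the class (`HasSobolevExtensionPast`) is in particular a classical
continuation (`HasSobolevExtensionPast.hasSmoothExtensionPast`), excluded by maximality.
[cite: BealeKatoMajda1984, Theorem 1 and Corollary] -/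
theorem not_hasSobolevExtensionPast_of_isMaximalSmoothSolution
    (hmax : IsMaximalSmoothSolution ν 0 u p T) : ¬ HasSobolevExtensionPast ν u T :=
  fun h => hmax.2 h.hasSmoothExtensionPast

end Witness

/-- **Beale–Kato–Majda at the crux: every witness of `CertifiedBlowupAxisymBlowup` is a vorticity
blow-up** (registered stub of stmt-NavierStokesRegularity-0727). A maximal Leray–Hopf classical
solution `(u, p)` of viscosity `ν > 0` and finite lifespan `T > 0` from a rapidly decaying
axisymmetric datum lies in the BKM class `⋂ₛ L^∞([0, T'']; H^s)` on every earlier slab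
(`hasBoundedSobolevNormsOn_before_of_lerayHopf_classical`), admits no continuation in that class
past `T` (`not_hasSobolevExtensionPast_of_isMaximalSmoothSolution`), and therefore
`∫₀ᵀ ‖curl u(t)‖_{L^∞} dt = ∞` by the discharged blow-up form of the Beale–Kato–Majda criterion
(`lintegral_iSup_curl_eq_top_of_not_hasSobolevExtensionPast_holds`; Beale–Kato–Majda 1984, Thm. 1
as printed, the Navier–Stokes case being Majda–Bertozzi 2002, Thm. 4.3). The axisymmetry of the
datum is not used. [cite: BealeKatoMajda1984, Theorem 1 and Corollary] -/
theorem lintegral_iSup_curl_eq_top_of_isMaximalSmoothSolution : ∀ {ν T : ℝ} {u : ℝ → EuclideanSpace ℝ (Fin 3) → EuclideanSpace ℝ (Fin 3)} {p : ℝ → EuclideanSpace ℝ (Fin 3) → ℝ}, 0 < ν → 0 < T → IsMaximalSmoothSolution ν 0 u p T → IsLerayHopfOn T ν 0 (u 0) u → HasRapidSpatialDecay (u 0) → IsAxisymmetric (u 0) → (∀ T'' < T, HasBoundedSobolevNormsOn (Set.Icc 0 T'') u) ∧ ¬ HasSobolevExtensionPast ν u T ∧ (∫⁻ t in Set.Ioo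 0 T, ⨆ x, ‖curl (u t) x‖ₑ) = ⊤ := by
  intro ν T u p hν hT hmax hLH hdec _
  have hreg : ∀ T'' < T, HasBoundedSobolevNormsOn (Icc 0 T'') u :=
    hasBoundedSobolevNormsOn_before_of_lerayHopf_classical hν hT hmax.1 hLH hdec
  have hnot : ¬ HasSobolevExtensionPast ν u T :=
    not_hasSobolevExtensionPast_of_isMaximalSmoothSolution hmax
  exact ⟨hreg, hnot,
    lintegral_iSup_curl_eq_top_of_not_hasSobolevExtensionPast_holds hν.le hT hmax.1 hreg hnot⟩

end Summit.NavierStokesRegularity.NavierStokesRegularity.Theorems.CertifiedBlowupAxisymBlowup.CompactAmplification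

end
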